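import Summits.BirchSwinnertonDyer.BirchSwinnertonDyer.Theorems.GenusKolyvaginAtTwoOffCutResidualAtTwoRLw2PhantomExclusionGlue
import Summits.BirchSwinnertonDyer.BirchSwinnertonDyer.Theorems.GenusKolyvaginAtTwoOffCutResidualAtTwoRLw2TateWitness
import HarnessLib

/-!
# Route `GenusKolyvaginAtTwo`, residual `OffCutResidualAtTwoR` (stmt-BirchSwinnertonDyer-31767), LINE 26 «lw2_phantom_exclusion»:
# THE GLUE WITH THE `2`-MULTIPLICATIVE SLICE ABSORBED — `OffCutResidualAtTwoR` BY NAME from the route's served items and the residual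
# R₂⁗ = «NO multiplicative prime AT ALL (integral `j`) ∧ `#Sel₂ ≠ 1` ∧ `¬LW₂`» ∨ slices 2–3

Width seat `bsd-line-gk2-p5` g41 (cell `bsd-f1-sign2`), `--supports stmt-BirchSwinnertonDyer-31767 --as helper`.  ONE THEOREM (no definition, no named
fact, no `sorry`).  **BSD is NOT proved by this file; `OffCutResidualAtTwoR` is NOT closed by it (it is reduced to R₂⁗, a hypothesis).**

gk2-p4 g31's adoption certificate `offCutResidualAtTwoR_of_items_of_lw2Residual` reduces the crux to R₂ = (slice 1: «no ODD multiplicative prime» ∧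
`#Sel₂ ≠ 1` ∧ `¬LW₂(W)`) ∨ slice 2 ∨ slice 3.  By this seat's Tate witness at `v ∣ 2` (`exists_levelTwoWitness_rat_of_exists_multiplicative`: a habitat
curve with ANY multiplicative prime — the place `2` included — satisfies `LW₂(W)`), the conjunct «no ODD multiplicative prime» of slice 1 can be replaced
by «no multiplicative prime at all» — on the habitat (`Odd (∏ c_p)` excludes the additive potentially-multiplicative types `I_n^*`) this is «`j(E) ∈ ℤ`»:
`offCutResidualAtTwoR_of_items_of_noMultResidual : hP → hPG → hQ1 → hQ2 → hQ5R → hGf → hTw → hL → hGZ → hGZK → hMi → R₂⁗ → OffCutResidualAtTwoR`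
with R₂⁗ = R₂ VERBATIM except that `((2 : ℕ) : 𝓞 ℚ) ∉ v.asIdeal ∧` is DELETED from the first conjunct.  (The `¬LW₂` conjunct is kept: it still removes the
`2`-additive cells with a `2`-adic witness — 7 of 23 below `5·10⁵` — which no theorem here covers.)  A rev-60 restate `OffCutResidualAtTwoR → R₂⁗` would
re-glue `closes` through this theorem (pure planner act).  BSD is NOT proved by this.

References: [LawsonWuthrich2016] §7.1, §8; [SilvermanATAEC1994] proof of Prop. V.6.1, Thm. V.5.3; [GrossLMS1991] §9.
-/

set_option linter.dupNamespace false -- tree convention: `Summit.BirchSwinnertonDyer.BirchSwinnertonDyer.Theorems` (summit = sub-problem)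
set_option autoImplicit false

noncomputable section

open scoped Classical NumberField

namespace Summit.BirchSwinnertonDyer.BirchSwinnertonDyer.Theorems.GenusExact.Lw2PhantomExclusion

open WeierstrassCurve NumberField Field IsDedekindDomain
open Literature.NumberTheory.EllipticCurves Literature.NumberTheory.GaloisRepresentations
  Literature.NumberTheory.EllipticCurves.ModularForms
open Summit.BirchSwinnertonDyer.BirchSwinnertonDyer.Theses.GenusKolyvaginAtTwo

/-- ★★ **`OffCutResidualAtTwoR` from the route's served items and the residual R₂⁗ (slice 1 = NO multiplicative prime of any parity ∧ `#Sel₂ ≠ 1` ∧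
`¬LW₂`; slices 2–3 verbatim).**  gk2-p4's glue `offCutResidualAtTwoR_of_items_of_lw2Residual` with its residual hypothesis R₂ discharged from R₂⁗: a slice-1
curve with `¬LW₂(W)` has no multiplicative prime at all, because a multiplicative prime (odd or `2`) is a level-2 witness
(`exists_levelTwoWitness_rat_of_exists_multiplicative`, the Tate witness).  Kernel-checked; the crux is NOT closed (R₂⁗ is a hypothesis); BSD is NOT proved.
[cite: LawsonWuthrich2016, §7.1 and §8] [cite: SilvermanATAEC1994, proof of Prop. V.6.1 (PDF p. 411)] -/
theorem offCutResidualAtTwoR_of_items_of_noMultResidual (hP : GenusPrimitiveSupplyAtTwoPosDiscShallow) (hPG : GenusDeepSupplyAtTwoNegDiscNarrow)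
    (hQ1 : CyclicTorsionOfNegDisc) (hQ2 : KolyvaginRelationAtTwo) (hQ5R : EquivariantChebotarevAtTwoR)
    (hGf : ExactDescentAtTwoOfFourFacts) (hTw : MinimalTwinBSDTwo) (hL : EntireLFunctionRat) (hGZ : GrossZagierAllLevels)
    (hGZK : MultPublishedInputsAtTwo) (hMi : MilneAnyModel)
    (hres :
      ∀ (W : WeierstrassCurve ℚ) [W.IsElliptic] [W.IsGloballyMinimal] [NeZero (W.conductorNorm ℤ)], ¬ W.HasCM → W.analyticRank = 0 → (∀ n : ℕ, 0 < n → W.HasSurjectiveModNGaloisRep ((2 : ℤ) ^ n)) → Odd W.tamagawaProduct → (∃ Dt : Literature.NumberTheory.EllipticCurves.ModularForms.ModularParametrizationData W (W.conductorNorm ℤ), (∀ z ∈ Dt.L.lattice, ∃ w ∈ Literature.NumberTheory.EllipticCurves.ModularForms.periodLattice Dt.f, z = (Dt.c : ℂ) * w) ∧ Odd Dt.c) → ((¬ (∃ v : IsDedekindDomain.HeightOneSpectrum (NumberField.RingOfIntegers ℚ), ((W.conductorNorm ℤ : ℕ) : NumberField.RingOfIntegers ℚ) ∈ v.asIdeal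 ∧ W.HasMultiplicativeReductionAt v)) ∧ Nat.card (W.selmerGroup 2) ≠ 1 ∧
      ¬ (∃ v : HeightOneSpectrum (𝓞 ℚ), ((W.conductorNorm ℤ : ℕ) : 𝓞 ℚ) ∈ v.asIdeal ∧
      (∀ z : galH1Torsion W 2, z ≠ 0 → (∀ ρ ∈ torsionFixing W 4, h1Eval W 2 z ρ = 0) →
      z ∉ selmerLocalKer W (v.adicCompletion ℚ) 2))) ∨ (W.Δ < 0 ∧ ¬ (Nat.card (W.selmerGroup 2) = 1 ∨ Nat.card (W.selmerGroup 2) = 4)) ∨ (0 < W.Δ ∧ ¬ (Nat.card (W.selmerGroup 2) = 1 ∨ (Nat.card (W.selmerGroup 2) = 4 ∧ ∃ c ∈ (W.kummerSelmerStructure ((2 : ℕ) : ℤ)).selmerGroup, Literature.NumberTheory.GaloisRepresentations.galoisCohomology.localization (W.torsionGaloisModule ((2 : ℕ) : ℤ)) (Sum.inl Rat.infinitePlace) 1 c ≠ 0))) → Literature.NumberTheory.EllipticCurves.BSDp W 2) :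
    OffCutResidualAtTwoR := by
  refine offCutResidualAtTwoR_of_items_of_lw2Residual hP hPG hQ1 hQ2 hQ5R hGf hTw hL hGZ hGZK hMi ?_
  intro W _ _ _ hcm hr0 hρ hT hopt hslice
  refine hres W hcm hr0 hρ hT hopt ?_
  rcases hslice with ⟨-, h1, hnLW⟩ | h23
  · refine Or.inl ⟨?_, h1, hnLW⟩
    rintro ⟨v, hNv, hmult⟩
    exact hnLW (exists_levelTwoWitness_rat_of_exists_multiplicative W hT hρ ⟨v, hNv, hmult⟩)
  · exact Or.inr h23

end Summit.BirchSwinnertonDyer.BirchSwinnertonDyer.Theorems.GenusExact.Lw2PhantomExclusion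

end
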